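import Summits.CriticalPhenomena.PercolationContinuityZ3.Theorems.Transplant.SkelPhiStepINegDefs
import Summits.CriticalPhenomena.PercolationContinuityZ3.Theorems.Transplant.SkelPhiFatSeqOff
import Summits.CriticalPhenomena.PercolationContinuityZ3.Theorems.Transplant.KNLevelsEquivariance
import HarnessLib

/-!
# N1 (the {±1} node), LEVEL 0, file (L0-4c): FRAME TRANSPORT of the Step-I″ inputs — the input of TYPE `t` realised at a CENTRE `c` (`StepI.eventNAt D t c`,
# geometry `(h, ℓ, v)` of the type, location `c`), the frame images of the fat parallelogram and of the `W`-pieces, `real_eventNAt_frame`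
# (`P` at `c` = `P` at `t` along a frame automorphism, for `D.Λ = fatSeq`), and `exists_inputsN_at_center` (at every vertex all indexed inputs are likely)

builds on p205010 (kernel theorem, internal audit signed; external expert review pending) — nothing here uses p205010; nothing is claimed about the open node
`SamePDropOfSkeletonNeg`.  Lane `prim-bschramm`, seat `prim-bschramm-p3` (gen 8; design owner); helper file (`--supports stmt-CriticalPhenomena-4575`); NEG-SCOPE §3
(inputs family + frame transport).  Mirrors D″'s `SkelPhiInputsFrame` for the record `StepI.DataN`.
[cite: KozmaNitzan2024, §4 pp. 19–21 ((21)–(25)) (inputs at every centre by translation)] [cite: MartineauTassion2017, §3.3 Lemma 3.7]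
-/

noncomputable section

namespace Summit.CriticalPhenomena.PercolationContinuityZ3.Theorems.Transplant

namespace Skelφ

namespace StepI

open MeasureTheory Literature.Probability.Percolation Literature.Probability.LatticeModels SimpleGraph KNLevels
open scoped Classical

variable {V : Type} {G : SimpleGraph V} {φ : V → Site 2} {types : Finset V}

/-! ## §1 The type-`t` input at a centre `c` -/

variable (G φ) in
/-- The link region of type `t` at centre `c`. [cite: MartineauTassion2017, §3.1 (R(a,b))] -/
def regionNAt [G.LocallyFinite] (D : DataN V) (t c : V) (M n : ℕ) : Set V :=
  pgramPrism G φ c n (D.hgt t M n) (3 * D.len t M n) (D.R (D.scale t M n))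

variable (G φ) in
/-- The piece `(fam, σ, τ)` of type `t` at centre `c`. [cite: MartineauTassion2017, §3.2 (𝒵(a,b,u,v))] -/
def pieceNAt [G.LocallyFinite] (D : DataN V) (t c : V) (M n : ℕ) (fam : Fin 2) (σ τ : ℤˣ) : Finset V :=
  if fam = 0 then pgSideHalfW G φ c n (D.hgt t M n) (D.len t M n) (D.R (D.scale t M n)) (σ : ℤ) (τ : ℤ)
  else pgTopPieceW G φ c n (D.hgt t M n) (D.len t M n) (D.R (D.scale t M n)) (σ : ℤ) (τ : ℤ) (D.spl t M n)

variable (G φ) in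
/-- **The input of type `t` realised at centre `c`**: zone of `D.Λ c`, resp. the piece-link with the type's geometry drawn around `c`. [this work] -/
def eventNAt [G.LocallyFinite] (D : DataN V) (t c : V) : ℕ × Option (ℕ × Fin 2 × ℤˣ × ℤˣ) → Set (BondConfig V)
  | (M, none) => UniqZone.zone G (D.Λ c) D.k M
  | (M, some (n, fam, σ, τ)) => linkIn (regionNAt G φ D t c M n) (D.Λ c D.k) (pieceNAt G φ D t c M n fam σ τ)

/-- At the base vertex itself the realised input is the input. [folklore] -/
theorem eventNAt_self [G.LocallyFinite] (D : DataN V) (t : V) (x : ℕ × Option (ℕ × Fin 2 × ℤˣ × ℤˣ)) :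
    eventNAt G φ D t t x = eventN G φ D (t, x) := by
  obtain ⟨M, og⟩ := x
  rcases og with _ | ⟨n, fam, σ, τ⟩ <;> rfl

/-- The zone input at `c`, unfolded. [folklore] -/
@[simp] theorem eventNAt_none [G.LocallyFinite] (D : DataN V) (t c : V) (M : ℕ) : eventNAt G φ D t c (M, none) = UniqZone.zone G (D.Λ c) D.k M := rfl

/-- The piece-link input at `c`, unfolded. [folklore] -/
@[simp] theorem eventNAt_some [G.LocallyFinite] (D : DataN V) (t c : V) (M n : ℕ) (fam : Fin 2) (σ τ : ℤˣ) :
    eventNAt G φ D t c (M, some (n, fam, σ, τ)) = linkIn (regionNAt G φ D t c M n) (D.Λ c D.k) (pieceNAt G φ D t c M n fam σ τ) := rfl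

/-- The realised pieces lie in the realised link region. [folklore] -/
theorem coe_pieceNAt_subset [G.LocallyFinite] (D : DataN V) (t c : V) (M n : ℕ) (fam : Fin 2) (σ τ : ℤˣ) :
    (↑(pieceNAt G φ D t c M n fam σ τ) : Set V) ⊆ regionNAt G φ D t c M n := by
  unfold pieceNAt regionNAt
  split_ifs
  · exact coe_pgSideHalfW_subset c n _ _ _ _ _
  · exact coe_pgTopPieceW_subset c n _ _ _ _ _ _

/-! ## §2 Frame images -/

section Frame

variable [G.LocallyFinite] {α : G ≃g G} {t c : V} (hαt : α t = c) (hφ : ∀ w, φ (α w) = φ w + (φ c - φ t))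
include hφ

omit [G.LocallyFinite] in
/-- Frames preserve relative coordinates. [folklore] -/
theorem relCoord_frame_apply (i : Fin 2) (w : V) : relCoord φ c i (α w) = relCoord φ t i w := by
  simp only [relCoord_apply, hφ w, Pi.add_apply, Pi.sub_apply]; ring

omit [G.LocallyFinite] in
/-- Frames preserve the sheared coordinate. [folklore] -/
theorem shearCoord_frame_apply (n : ℕ) (h : ℤ) (w : V) : shearCoord φ c n h (α w) = shearCoord φ t n h w := by
  simp only [shearCoord_apply, hφ w, Pi.add_apply, Pi.sub_apply]; ring

omit [G.LocallyFinite] in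
/-- Frames carry parallelogram cylinders onto parallelogram cylinders. [folklore] -/
theorem mem_pgramCyl_frame (n : ℕ) (h : ℤ) (ℓ : ℕ) (w : V) : α w ∈ pgramCyl φ c n h ℓ ↔ w ∈ pgramCyl φ t n h ℓ := by
  rw [mem_pgramCyl, mem_pgramCyl, relCoord_frame_apply hφ, shearCoord_frame_apply hφ]

include hαt

/-- A frame carries the fat parallelogram at `t` onto the one at `c` (finset form). [folklore] -/
theorem image_frame_pgramPrismFin (n : ℕ) (h : ℤ) (ℓ R : ℕ) : (pgramPrismFin G φ t n h ℓ R).image α = pgramPrismFin G φ c n h ℓ R := by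
  ext v
  simp only [Finset.mem_image, mem_pgramPrismFin, mem_pgramPrism]
  constructor
  · rintro ⟨u, ⟨hu1, hu2⟩, rfl⟩
    exact ⟨by rw [← image_cylBall_of_frame hαt hφ]; exact ⟨u, hu1, rfl⟩, (mem_pgramCyl_frame hφ n h ℓ u).2 hu2⟩
  · rintro ⟨hv1, hv2⟩
    rw [← image_cylBall_of_frame hαt hφ] at hv1
    obtain ⟨u, hu, rfl⟩ := hv1
    exact ⟨u, ⟨hu, (mem_pgramCyl_frame hφ n h ℓ u).1 hv2⟩, rfl⟩

/-- A frame carries `W`-side halves onto `W`-side halves. [folklore] -/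
theorem image_frame_pgSideHalfW (n : ℕ) (h : ℤ) (ℓ R : ℕ) (σ τ : ℤ) : (pgSideHalfW G φ t n h ℓ R σ τ).image α = pgSideHalfW G φ c n h ℓ R σ τ := by
  ext v
  simp only [Finset.mem_image, mem_pgSideHalfW, ← mem_pgramPrismFin]
  constructor
  · rintro ⟨u, ⟨hu1, hu2, hu3, hu4⟩, rfl⟩
    refine ⟨?_, (mem_pgramCyl_frame hφ n h ℓ u).2 hu2, by rwa [relCoord_frame_apply hφ], by rwa [shearCoord_frame_apply hφ]⟩
    rw [← image_frame_pgramPrismFin hαt hφ]; exact Finset.mem_image_of_mem _ hu1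
  · rintro ⟨hv1, hv2, hv3, hv4⟩
    rw [← image_frame_pgramPrismFin hαt hφ, Finset.mem_image] at hv1
    obtain ⟨u, hu, rfl⟩ := hv1
    exact ⟨u, ⟨hu, (mem_pgramCyl_frame hφ n h ℓ u).1 hv2, by rwa [relCoord_frame_apply hφ] at hv3, by rwa [shearCoord_frame_apply hφ] at hv4⟩, rfl⟩

/-- A frame carries `W`-top pieces onto `W`-top pieces. [folklore] -/
theorem image_frame_pgTopPieceW (n : ℕ) (h : ℤ) (ℓ R : ℕ) (σ τ v : ℤ) :
    (pgTopPieceW G φ t n h ℓ R σ τ v).image α = pgTopPieceW G φ c n h ℓ R σ τ v := by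
  ext x
  simp only [Finset.mem_image, mem_pgTopPieceW, ← mem_pgramPrismFin]
  constructor
  · rintro ⟨u, ⟨hu1, hu2, hu3, hu4⟩, rfl⟩
    refine ⟨?_, (mem_pgramCyl_frame hφ n h ℓ u).2 hu2, by rwa [shearCoord_frame_apply hφ], by rwa [relCoord_frame_apply hφ]⟩
    rw [← image_frame_pgramPrismFin hαt hφ]; exact Finset.mem_image_of_mem _ hu1
  · rintro ⟨hv1, hv2, hv3, hv4⟩
    rw [← image_frame_pgramPrismFin hαt hφ, Finset.mem_image] at hv1
    obtain ⟨u, hu, rfl⟩ := hv1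
    exact ⟨u, ⟨hu, (mem_pgramCyl_frame hφ n h ℓ u).1 hv2, by rwa [shearCoord_frame_apply hφ] at hv3, by rwa [relCoord_frame_apply hφ] at hv4⟩, rfl⟩

/-- A frame carries the fat seeds at `t` onto those at `c`. [folklore] -/
theorem image_frame_fatSeq [Countable V] (hfr : Frames G φ types) {p : unitInterval} (hC : CylSubcritical G φ types p) (k : ℕ) :
    (fatSeq hfr hC t k).image α = fatSeq hfr hC c k := by
  ext v
  rw [Finset.mem_image, mem_fatSeq_iff, ← image_cylBall_of_frame hαt hφ k (fatRadius hfr hC k)]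
  constructor
  · rintro ⟨u, hu, rfl⟩; exact ⟨u, (mem_fatSeq_iff hfr hC).1 hu, rfl⟩
  · rintro ⟨u, hu, rfl⟩; exact ⟨u, (mem_fatSeq_iff hfr hC).2 hu, rfl⟩

/-- **The realised input at `c` has the probability of the input at `t`** (`D.Λ = fatSeq`). [cite: KozmaNitzan2024, §4 p. 20 ((22)–(23))] -/
theorem real_eventNAt_frame [Countable V] (hfr : Frames G φ types) {p : unitInterval} (hC : CylSubcritical G φ types p) (q : unitInterval)
    {D : DataN V} (hD : D.Λ = fatSeq hfr hC) (x : ℕ × Option (ℕ × Fin 2 × ℤˣ × ℤˣ)) :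
    (bondPercolation G q).real (eventNAt G φ D t c x) = (bondPercolation G q).real (eventN G φ D (t, x)) := by
  obtain ⟨M, og⟩ := x
  rcases og with _ | ⟨n, fam, σ, τ⟩
  · rw [eventNAt_none, eventN_none, hD, ← show (fun i => (fatSeq hfr hC t i).image α) = fatSeq hfr hC c from funext (image_frame_fatSeq hαt hφ hfr hC)]
    exact real_zone_image_iso α q _ D.k M
  · rw [eventNAt_some, eventN_some, hD, regionNAt, regionN, ← coe_pgramPrismFin, ← coe_pgramPrismFin, ← image_frame_pgramPrismFin hαt hφ,
      ← image_frame_fatSeq hαt hφ hfr hC D.k]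
    unfold pieceNAt pieceN
    split_ifs
    · rw [← image_frame_pgSideHalfW hαt hφ]; exact real_linkIn_image_iso α q _ _ _
    · rw [← image_frame_pgTopPieceW hαt hφ]; exact real_linkIn_image_iso α q _ _ _

end Frame

/-! ## §3 The inputs at every vertex -/

/-- **The Step-I″ inputs at every vertex**: if every input over `indexN types Sz Sn` has probability `> 1 − δ` at `q`, then every vertex `c` has a type `t ∈ types`
such that AT `c` the zone of every `M ∈ Sz` and all eight piece-links of type `t` at every `(M, n) ∈ Sz × Sn` have probability `> 1 − δ`.
[cite: KozmaNitzan2024, §4 pp. 19–21 ((21)–(25))] -/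
theorem exists_inputsN_at_center [Countable V] [G.LocallyFinite] (hfr : Frames G φ types) {p : unitInterval} (hC : CylSubcritical G φ types p)
    {D : DataN V} (hD : D.Λ = fatSeq hfr hC) {Sz Sn : Finset ℕ} {q : unitInterval} {δ : ℝ}
    (h : ∀ i ∈ indexN types Sz Sn, 1 - δ < (bondPercolation G q).real (eventN G φ D i)) (c : V) :
    ∃ t ∈ types, (∀ M ∈ Sz, 1 - δ < (bondPercolation G q).real (eventNAt G φ D t c (M, none))) ∧
      ∀ M ∈ Sz, ∀ n ∈ Sn, ∀ (fam : Fin 2) (σ τ : ℤˣ), 1 - δ < (bondPercolation G q).real (eventNAt G φ D t c (M, some (n, fam, σ, τ))) := by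
  obtain ⟨t, ht, α, hαt, hφ⟩ := hfr c
  refine ⟨t, ht, fun M hM => ?_, fun M hM n hn fam σ τ => ?_⟩
  · rw [real_eventNAt_frame hαt hφ hfr hC q hD]; exact h _ (mem_indexN_none ht hM)
  · rw [real_eventNAt_frame hαt hφ hfr hC q hD]; exact h _ (mem_indexN_some ht hM hn fam σ τ)

end StepI

end Skelφ

end Summit.CriticalPhenomena.PercolationContinuityZ3.Theorems.Transplant

end
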